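import Summits.CriticalPhenomena.CardyFormulaZ2.Theses.CardyUSTContinuation
import Summits.CriticalPhenomena.CardyFormulaZ2.Theorems.CardyUSTContinuationContinuumFamilyHolo
import Literature.Probability.RandomPlanarGeometry.MillerWernerHookup

/-!
# `ContinuumFamily` (support item stmt-CriticalPhenomena-6052, route CardyUSTContinuation)

Facts about the explicit continuum family of the route
`U(t, η) = t Z(u,η) / (Z(u,1-η) + t Z(u,η))`, `u = arccos(-t/2)/π`,
`Z(u,x) = x^{u/2} (1-x)^{1-3u/2} ₂F₁(u, 1-u; 2u; x)` (Miller–Werner 2018 §4, in joint wiring):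

* (i) `U(1, η) = cardyFunction η` on `(0,1)`: `u(1) = 2/3`, `Z(2/3, ·) = millerWernerZ 6 = F/cardyConst`
  (`millerWernerZ_six`) and `F(η) + F(1-η) = 1` (`cardyFunction_one_sub_holds`);
* (ii) for each `η ∈ (0,1)`, `t ↦ U(t, η)` is the restriction to `[0,1]` of a function holomorphic on a
  complex `ρ`-neighbourhood of `[0,1]`: the explicit complexification through the arcsine branch,
  complex powers of the positive bases `η`, `1-η`, and the Gauss series as a holomorphic function of
  its parameter (tools in `CardyUSTContinuationContinuumFamilyHolo.lean`); the set where all branch /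
  parameter / denominator conditions hold is open and contains the compact segment `[0,1] ⊆ ℂ`, hence
  a uniform thickening of it (`IsCompact.exists_thickening_subset_open`).

The closing theorem is `Summit.CriticalPhenomena.CardyFormulaZ2.Theorems.continuumFamily_proof`.
-/

noncomputable section

open Set Filter Complex
open scoped Topology Real
open Literature.Probability.RandomPlanarGeometry

namespace Summit.CriticalPhenomena.CardyFormulaZ2.Theorems.ContinuumFamilyExt

/-- On `t ∈ [0,1]` the exponent `u = arccos(-t/2)/π` lies in `[1/2, 2/3]`. [folklore] -/
theorem arccos_div_pi_mem_Icc {t : ℝ} (ht : t ∈ Icc (0 : ℝ) 1) :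
    Real.arccos (-(t / 2)) / Real.pi ∈ Icc (1 / 2 : ℝ) (2 / 3) := by
  have hπ := Real.pi_pos
  have h1 : Real.arccos 0 ≤ Real.arccos (-(t / 2)) :=
    Real.antitone_arccos (by linarith [ht.1])
  have h2 : Real.arccos (-(t / 2)) ≤ Real.arccos (-1 / 2) :=
    Real.antitone_arccos (by linarith [ht.2])
  rw [Real.arccos_zero] at h1
  rw [arccos_neg_one_half] at h2
  constructor
  · rw [le_div_iff₀ hπ]; linarith
  · rw [div_le_iff₀ hπ]; linarith

/-! ### The Miller–Werner factor `Z(u, x)` and its complexification -/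

/-- Positivity of `Z(u,x) = x^{u/2}(1-x)^{1-3u/2} ₂F₁(u,1-u;2u;x)` for `0 < u ≤ 1`, `x ∈ (0,1)` (all
terms of the Gauss series are nonnegative, the zeroth is `1`). [folklore] -/
theorem mwZ_pos {u x : ℝ} (hu0 : 0 < u) (hu1 : u ≤ 1) (hx : x ∈ Ioo (0 : ℝ) 1) :
    0 < x ^ (u / 2) * (1 - x) ^ (1 - 3 * u / 2) * ₂F₁ u (1 - u) (2 * u) x := by
  have hF : 1 ≤ ₂F₁ u (1 - u) (2 * u) x :=
    one_le_ordinaryHypergeometric_of_nonneg hu0.le (by linarith) (by linarith) hx.1.le hx.2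
  have h1 : 0 < x ^ (u / 2) := Real.rpow_pos_of_pos hx.1 _
  have h2 : 0 < (1 - x) ^ (1 - 3 * u / 2) := Real.rpow_pos_of_pos (by linarith [hx.2]) _
  have h3 : 0 < ₂F₁ u (1 - u) (2 * u) x := by linarith
  positivity

/-- The real factor `Z(u,x)` cast to `ℂ` is its complexification (complex powers of the positive
bases `x`, `1-x` and the complex-parameter Gauss series) at the real parameter `u`. [folklore] -/
theorem ofReal_mwZ (u : ℝ) {x : ℝ} (hx0 : 0 ≤ x) (hx1 : x ≤ 1) :
    ((x ^ (u / 2) * (1 - x) ^ (1 - 3 * u / 2) * ₂F₁ u (1 - u) (2 * u) x : ℝ) : ℂ) =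
      (x : ℂ) ^ ((u : ℂ) / 2) * (1 - (x : ℂ)) ^ (1 - 3 * (u : ℂ) / 2) *
        ₂F₁ (u : ℂ) (1 - (u : ℂ)) (2 * (u : ℂ)) (x : ℂ) := by
  have h1x : (0 : ℝ) ≤ 1 - x := by linarith
  rw [Complex.ofReal_mul, Complex.ofReal_mul, Complex.ofReal_cpow hx0, Complex.ofReal_cpow h1x,
    ofReal_ordinaryHypergeometric]
  push_cast
  ring_nf

/-- Holomorphy of `t ↦ Z(v(t), x)` (complexified) at any `t` where the exponent map `v` is
holomorphic with value in the parameter region. [folklore] -/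
theorem differentiableAt_mwZc {v : ℂ → ℂ} {t : ℂ} {x : ℝ} (hx : x ∈ Ioo (0 : ℝ) 1)
    (hv : DifferentiableAt ℂ v t) (hvt : ‖v t‖ < 1 ∧ 1 / 4 < (v t).re) :
    DifferentiableAt ℂ (fun t => (x : ℂ) ^ (v t / 2) * (1 - (x : ℂ)) ^ (1 - 3 * v t / 2) *
      ₂F₁ (v t) (1 - v t) (2 * v t) (x : ℂ)) t := by
  have hx0 : (x : ℂ) ≠ 0 := Complex.ofReal_ne_zero.2 hx.1.ne'
  have hx1 : (1 : ℂ) - (x : ℂ) ≠ 0 := by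
    rw [← Complex.ofReal_one, ← Complex.ofReal_sub, Complex.ofReal_ne_zero]
    linarith [hx.2]
  have hA : DifferentiableAt ℂ (fun t => (x : ℂ) ^ (v t / 2)) t :=
    (hv.div_const 2).const_cpow (Or.inl hx0)
  have hB : DifferentiableAt ℂ (fun t => (1 - (x : ℂ)) ^ (1 - 3 * v t / 2)) t :=
    ((differentiableAt_const _).sub ((hv.const_mul 3).div_const 2)).const_cpow (Or.inl hx1)
  have hC : DifferentiableAt ℂ (fun t => ₂F₁ (v t) (1 - v t) (2 * v t) (x : ℂ)) t :=
    ((differentiableOn_ordinaryHypergeometric_param hx.1.le hx.2).differentiableAt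
      (isOpen_paramRegion.mem_nhds hvt)).comp t hv
  exact (hA.mul hB).mul hC

/-! ### Part (i): the `t = 1` member is Cardy's function -/

/-- **`U(1, η) = cardyFunction η`.** At `t = 1`, `u = arccos(-1/2)/π = 2/3`, the `(1-x)`-power
disappears, `Z(2/3, x) = x^{1/3} ₂F₁(2/3,1/3;4/3;x) = millerWernerZ 6 x = F(x)/cardyConst`, and
`F(η) + F(1-η) = 1` (`cardyFunction_one_sub_holds`). Stated for abstract `Z`, `U` satisfying the
route's `let`-definitions. [cite: MillerWerner2018, §4] -/
theorem continuumFamily_one (Z : ℝ → ℝ → ℝ) (U : ℝ → ℝ → ℝ)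
    (hZ : ∀ u x, Z u x = x ^ (u / 2) * (1 - x) ^ (1 - 3 * u / 2) * ₂F₁ u (1 - u) (2 * u) x)
    (hU : ∀ t η, U t η = t * Z (Real.arccos (-(t / 2)) / Real.pi) η /
      (Z (Real.arccos (-(t / 2)) / Real.pi) (1 - η) + t * Z (Real.arccos (-(t / 2)) / Real.pi) η))
    {η : ℝ} (hη : η ∈ Ioo (0 : ℝ) 1) : U 1 η = cardyFunction η := by
  have hπ := Real.pi_pos
  have hu : Real.arccos (-(1 / 2 : ℝ)) / Real.pi = 2 / 3 := by
    rw [show (-(1 / 2 : ℝ)) = -1 / 2 by norm_num, arccos_neg_one_half]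
    field_simp
  have hZ6 : ∀ x, Z (2 / 3) x = cardyFunction x / cardyConst := by
    intro x
    rw [← millerWernerZ_six, millerWernerZ_eq, hZ]
    norm_num
  rw [hU, hu, hZ6, hZ6, cardyFunction_one_sub_holds ⟨hη.1.le, hη.2.le⟩, one_mul]
  have hC := cardyConst_pos.ne'
  have hden : (1 - cardyFunction η) / cardyConst + cardyFunction η / cardyConst =
      1 / cardyConst := by ring
  rw [hden, div_div_div_cancel_right₀ hC, div_one]

/-! ### Part (ii): holomorphic extension in `t` -/

/-- **Holomorphic extension of `t ↦ U(t, η)` to a complex neighbourhood of `[0,1]`.** For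
`η ∈ (0,1)`, the explicit complexification `Uc(t) = t Zc(v(t),η) / (Zc(v(t),1-η) + t Zc(v(t),η))`
(`v` the complexified exponent, `Zc` the complexified Miller–Werner factor) is holomorphic on the open
set where the arcsine branch conditions hold, `v(t)` lies in the parameter region and the
denominator does not vanish; this open set contains the compact segment `[0,1] ⊆ ℂ`, hence one
of its `ρ`-thickenings, and `Uc = U(·, η)` on `[0,1]`. [folklore] -/
theorem continuumFamily_ext (Z : ℝ → ℝ → ℝ) (U : ℝ → ℝ → ℝ)
    (hZ : ∀ u x, Z u x = x ^ (u / 2) * (1 - x) ^ (1 - 3 * u / 2) * ₂F₁ u (1 - u) (2 * u) x)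
    (hU : ∀ t η, U t η = t * Z (Real.arccos (-(t / 2)) / Real.pi) η /
      (Z (Real.arccos (-(t / 2)) / Real.pi) (1 - η) + t * Z (Real.arccos (-(t / 2)) / Real.pi) η))
    {η : ℝ} (hη : η ∈ Ioo (0 : ℝ) 1) :
    ∃ ρ > (0 : ℝ), ∃ Uc : ℂ → ℂ,
      DifferentiableOn ℂ Uc (Metric.thickening ρ (((↑) : ℝ → ℂ) '' Icc (0 : ℝ) 1)) ∧
      ∀ t ∈ Icc (0 : ℝ) 1, Uc t = U t η := by
  have hη' : 1 - η ∈ Ioo (0 : ℝ) 1 := ⟨by linarith [hη.2], by linarith [hη.1]⟩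
  -- the complexified exponent, factor, denominator, and the good set
  set v : ℂ → ℂ := fun t => (1 : ℂ) / 2 +
      -I * Complex.log (I * (t / 2) + ((1 : ℂ) - (t / 2) ^ 2) ^ ((1 : ℂ) / 2)) / (Real.pi : ℂ)
    with hv
  set Zc : ℂ → ℝ → ℂ := fun p x => (x : ℂ) ^ (p / 2) * (1 - (x : ℂ)) ^ (1 - 3 * p / 2) *
      ₂F₁ p (1 - p) (2 * p) (x : ℂ) with hZc
  set D : ℂ → ℂ := fun t => Zc (v t) (1 - η) + t * Zc (v t) η with hD
  set G : Set ℂ := {t | ((1 : ℂ) - (t / 2) ^ 2 ∈ slitPlane ∧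
      I * (t / 2) + ((1 : ℂ) - (t / 2) ^ 2) ^ ((1 : ℂ) / 2) ∈ slitPlane) ∧
      (‖v t‖ < 1 ∧ 1 / 4 < (v t).re) ∧ D t ≠ 0} with hG
  -- differentiability at points of `G`
  have hdiff : ∀ t : ℂ, ((1 : ℂ) - (t / 2) ^ 2 ∈ slitPlane ∧
      I * (t / 2) + ((1 : ℂ) - (t / 2) ^ 2) ^ ((1 : ℂ) / 2) ∈ slitPlane) →
      (‖v t‖ < 1 ∧ 1 / 4 < (v t).re) →
      DifferentiableAt ℂ v t ∧ DifferentiableAt ℂ (fun t => Zc (v t) η) t ∧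
        DifferentiableAt ℂ D t := by
    rintro t ⟨h1, h2⟩ h3
    have hv' : DifferentiableAt ℂ v t := (differentiableAt_cexponent h1 h2).1
    have hZ1 : DifferentiableAt ℂ (fun t => Zc (v t) η) t := differentiableAt_mwZc hη hv' h3
    have hZ2 : DifferentiableAt ℂ (fun t => Zc (v t) (1 - η)) t := differentiableAt_mwZc hη' hv' h3
    exact ⟨hv', hZ1, hZ2.add (differentiableAt_id.mul hZ1)⟩
  have hUc : ∀ t ∈ G, DifferentiableAt ℂ (fun t => t * Zc (v t) η / D t) t := by
    rintro t ⟨h12, h3, h4⟩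
    obtain ⟨-, hZ1, hD'⟩ := hdiff t h12 h3
    exact (differentiableAt_id.mul hZ1).div hD' h4
  -- `G` is open
  have hGo : IsOpen G := by
    rw [isOpen_iff_eventually]
    rintro t ⟨⟨h1, h2⟩, h3, h4⟩
    obtain ⟨hv', -, hD'⟩ := hdiff t ⟨h1, h2⟩ h3
    have e1 : ∀ᶠ s in 𝓝 t, (1 : ℂ) - (s / 2) ^ 2 ∈ slitPlane :=
      (by fun_prop : Continuous fun s : ℂ => (1 : ℂ) - (s / 2) ^ 2).continuousAt.eventually_mem
        (isOpen_slitPlane.mem_nhds h1)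
    have e2 : ∀ᶠ s in 𝓝 t, I * (s / 2) + ((1 : ℂ) - (s / 2) ^ 2) ^ ((1 : ℂ) / 2) ∈ slitPlane :=
      (differentiableAt_cexponent h1 h2).2.eventually_mem (isOpen_slitPlane.mem_nhds h2)
    have e3 : ∀ᶠ s in 𝓝 t, ‖v s‖ < 1 ∧ 1 / 4 < (v s).re :=
      hv'.continuousAt.eventually_mem (isOpen_paramRegion.mem_nhds h3)
    have e4 : ∀ᶠ s in 𝓝 t, D s ≠ 0 := hD'.continuousAt.eventually_ne h4
    filter_upwards [e1, e2, e3, e4] with s h1 h2 h3 h4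
    exact ⟨⟨h1, h2⟩, h3, h4⟩
  -- values on the real segment
  have hreal : ∀ t : ℝ, t ∈ Icc (0 : ℝ) 1 →
      ((1 : ℂ) - ((t : ℂ) / 2) ^ 2 ∈ slitPlane ∧
        I * ((t : ℂ) / 2) + ((1 : ℂ) - ((t : ℂ) / 2) ^ 2) ^ ((1 : ℂ) / 2) ∈ slitPlane) ∧
      v t = ((Real.arccos (-(t / 2)) / Real.pi : ℝ) : ℂ) ∧
      Zc (v t) η = ((Z (Real.arccos (-(t / 2)) / Real.pi) η : ℝ) : ℂ) ∧
      Zc (v t) (1 - η) = ((Z (Real.arccos (-(t / 2)) / Real.pi) (1 - η) : ℝ) : ℂ) := by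
    intro t ht
    obtain ⟨h1, h2, h3⟩ := cexponent_ofReal (t := t) ⟨by linarith [ht.1], by linarith [ht.2]⟩
    have hvt : v t = ((Real.arccos (-(t / 2)) / Real.pi : ℝ) : ℂ) := h3
    refine ⟨⟨h1, h2⟩, hvt, ?_, ?_⟩
    · rw [hvt, hZ]; exact (ofReal_mwZ _ hη.1.le hη.2.le).symm
    · rw [hvt, hZ]; exact (ofReal_mwZ _ hη'.1.le hη'.2.le).symm
  -- the segment lies in `G`
  have hKG : ((↑) : ℝ → ℂ) '' Icc (0 : ℝ) 1 ⊆ G := by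
    rintro _ ⟨t, ht, rfl⟩
    obtain ⟨h12, hvt, hZ1, hZ2⟩ := hreal t ht
    have hu := arccos_div_pi_mem_Icc ht
    have hZpos : ∀ x ∈ Ioo (0 : ℝ) 1, 0 < Z (Real.arccos (-(t / 2)) / Real.pi) x := by
      intro x hx
      rw [hZ]
      exact mwZ_pos (by linarith [hu.1]) (by linarith [hu.2]) hx
    refine ⟨h12, ?_, ?_⟩
    · rw [hvt]
      refine ⟨?_, ?_⟩
      · rw [Complex.norm_real, Real.norm_eq_abs, abs_of_nonneg (by linarith [hu.1])]
        linarith [hu.2]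
      · rw [Complex.ofReal_re]
        linarith [hu.1]
    · have hDt : D t = ((Z (Real.arccos (-(t / 2)) / Real.pi) (1 - η) +
          t * Z (Real.arccos (-(t / 2)) / Real.pi) η : ℝ) : ℂ) := by
        simp only [hD]
        rw [hZ1, hZ2]
        push_cast
        ring
      rw [hDt, Complex.ofReal_ne_zero]
      have hp1 := hZpos η hη
      have hp2 := hZpos (1 - η) hη'
      have ht0 : 0 ≤ t := ht.1
      positivity
  -- a uniform thickening of the segment inside `G`
  obtain ⟨ρ, hρ, hsub⟩ :=
    (isCompact_Icc.image Complex.continuous_ofReal).exists_thickening_subset_open hGo hKG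
  refine ⟨ρ, hρ, fun t => t * Zc (v t) η / D t,
    fun t ht => (hUc t (hsub ht)).differentiableWithinAt, ?_⟩
  intro t ht
  obtain ⟨-, -, hZ1, hZ2⟩ := hreal t ht
  show (t : ℂ) * Zc (v t) η / (Zc (v t) (1 - η) + t * Zc (v t) η) = ((U t η : ℝ) : ℂ)
  rw [hZ1, hZ2, hU]
  push_cast
  ring

end Summit.CriticalPhenomena.CardyFormulaZ2.Theorems.ContinuumFamilyExt

namespace Summit.CriticalPhenomena.CardyFormulaZ2.Theorems

open ContinuumFamilyExt

/-! ### The item -/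

/-- **`ContinuumFamily`** (item stmt-CriticalPhenomena-6052 of route `CardyUSTContinuation`):
(i) the `t = 1` member of the Miller–Werner family in joint wiring is Cardy's function,
`U(1, η) = cardyFunction η` on `(0,1)`; (ii) for each `η ∈ (0,1)` the map `t ↦ U(t, η)` is the
restriction to `[0,1]` of a function holomorphic on a complex `ρ`-neighbourhood of `[0,1]`.
[cite: MillerWerner2018, §4] -/
theorem continuumFamily_proof :
    Summit.CriticalPhenomena.CardyFormulaZ2.Theses.CardyUSTContinuation.ContinuumFamily := by
  unfold Summit.CriticalPhenomena.CardyFormulaZ2.Theses.CardyUSTContinuation.ContinuumFamily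
  intro Z U
  exact ⟨fun η hη => continuumFamily_one Z U (fun _ _ => rfl) (fun _ _ => rfl) hη,
    fun η hη => continuumFamily_ext Z U (fun _ _ => rfl) (fun _ _ => rfl) hη⟩

end Summit.CriticalPhenomena.CardyFormulaZ2.Theorems
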